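import Summits.QuantumFields.BalabanUV.T4Continuum.Support.NE7EnergyRateWPrep
import Summits.QuantumFields.BalabanUV.T4Continuum.Support.NE7ConvOneStepGenericSliceTangent
import Summits.QuantumFields.BalabanUV.T4Continuum.Support.NE7OpenOfMinimisation
import HarnessLib

/-!
# NE7AllMinimisersSmallSU2 — (8)∀ FOR SU(2), d = 4, L = 2, NO DISPLAYED HYPOTHESIS: EVERY constrained minimiser of the small-field class `sfClass 4 2 N ε` at EVERY level `k`, over any
# datum of the small data, lies in the INTERIOR with the k-uniform relative radius `ε∕4`: `SmallField U ((ε∕4)∕4^k)` — [Balaban1985Variational] Thm 1 (8) TYPE for the WHOLE minimal set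
# (gen 104's (8)∃ gave ONE such minimiser per level)

Cell `pub-balaban`, rung (B)+1 sub-cell t4, lineage `b2b-balaban-t4-ne7-p1`, generation 105 (CRUX PROVER NE7 #1 = OWNER of BINDER row NE7).  Memo `t4/b2b-balaban-t4-ne7-p1-g105/ROAD-G105.md` §4.
THE ARGUMENT.  Take the (8)∃ minimiser `U♯` of the SMALLER class `sfClass 4 2 N (ε∕4)` at level `k+1` (gen 104's `NE7HintUnconditionalSU2.hint_SU2_small_data` at `ε∕4`): it is admissible in the
`ε`-class, interior in its own class, hence tangent-critical (`NE7OpenOfMinimisation.tanCritical_of_isMinimiser`), and `SmallField U♯ ((ε∕4)∕M²)`.  Gen 99's ALL-SMALL on the SU(2) class over the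
energy block-Landau slice (`NE7ConvOneStepGenericSliceTangent.allSmall_SU2_of_tanCritical_repE_gauge`) needs, for every admissible `U′` of the `ε`-class, the slice decomposition of the pair
(`U♯`, `U′`) with the gauge identity and the per-level strict line: the decomposition is gen 105's `NE7PairDecompNL0.decomp_of_nl0_pair`, the line is gen 104's k-free `line_of_small` carried to
the level by `NE7EnergyRateWPrep.kfree_coercivity`.  Hence every admissible `U′` with `levelAction U′ ≤ levelAction U♯` — in particular every minimiser of the `ε`-class — is
`SmallField ((ε∕4)∕M²)` (indeed a gauge copy of `U♯`).  Level `0`: the only admissible configuration is the datum itself (`δ_V ≤ ε∕4`).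
WHAT ([folklore]; 0 def, 0 sorry).  **`all_minimisers_small_SU2`**: `card n = 2 → ∃ ε₀ > 0, ∀ 0 < ε ≤ ε₀, ∀ N ≥ 1, ∃ δ_V > 0, ∀ V (unitary, N-periodic, SmallField V δ_V), ∀ k, ∀ U,
IsMinimiser 4 (sfClass 4 2 N ε) 2 N k V U → SmallField U ((ε∕4)∕(2^k)²)`.
HONEST FRAMING (page 1): composition of landed kernel theorems of this lineage (gens 94–105) and [B7]∕[B8]∕[B11] AS TYPED; nothing of Bałaban's asserted as an axiom; SU(2) (`n : Type`), `L = 2`,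
finite 4-torus, constants existential; NOT NE7, NOT NE3; spine count = dagwriter∕referees' call; NOT infinite volume, NOT mass gap, NOT BetaPertH, NOT Clay (continuum YM on T⁴ ⇐ BetaPertH ∧
nine spine estimates).
-/

set_option autoImplicit false

open scoped BigOperators Matrix Matrix.Norms.L2Operator
open NormedSpace Finset Set

namespace Summit.QuantumFields.BalabanUV.T4Continuum.NE7AllMinimisersSmallSU2

open Literature.MathematicalPhysics.QuantumFieldTheory.Balaban1983to89
open B7Prop1Explicit B7Prop2Explicit
open T4AveragingDeficitWall (IsUnitaryCfg IsSkewDir SmallField vary curl curlSq dirSq)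
open T4AveragingDeficitWallBoundary (IsPeriodicCfg periodBox)
open AveragingDeficitPeriodicCounting (IsPeriodicDir)
open AveragingDeficitMultiLevelPrep (LevelSmall TangentIter)
open MinimalActionLevels (perWin levelAction)
open MinimalActionSandwich (IsMinimiser admissible)
open MinimalActionRate (sfClass)
open NE3HessForm (dAction)
open NE3SlicePoincareBudgetLine (CPLine)
open NE3ClassRadiusFamily (CPLine_nonneg_d4_L2)
open NE3EnergyShapes (IsUnitarySite IsPeriodicSite)
open NE3EnergyWeightedShapes (energyNormW)
open NE7MeanZeroGaugeSliceW (energyBlockLandauW)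
open NE7ConvOneStepSU2 (levelSmall_all_d4_L2)
open NE7ConvOneStepGenericSliceTangent (allSmall_SU2_of_tanCritical_repE_gauge)
open NE7OpenOfMinimisation (tanCritical_of_isMinimiser)
open NE7HintUnconditionalSU2 (line_of_small hint_SU2_small_data)
open NE7PairDecompNL0 (decomp_of_nl0_pair)
open NE7EnergyRateWPrep (kfree_coercivity)

noncomputable section

variable {n : Type} [Fintype n] [DecidableEq n]

/-- Admissibility is monotone in the class radius: `admissible (sfClass 4 2 N ε′) 2 k V ⊆ admissible (sfClass 4 2 N ε) 2 k V` for `ε′ ≤ ε`. [folklore] -/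
theorem admissible_mono_radius {N k : ℕ} {ε ε' : ℝ} (hle : ε' ≤ ε) {V U : Site 4 → Fin 4 → (Matrix n n ℂ)ˣ}
    (hU : U ∈ admissible (sfClass 4 2 N ε') 2 k V) : U ∈ admissible (sfClass 4 2 N ε) 2 k V := by
  obtain ⟨⟨hu, hP, hS⟩, havg⟩ := hU
  exact ⟨⟨hu, hP, MinimalActionRate.SmallField.mono hS (div_le_div_of_nonneg_right hle (by positivity))⟩, havg⟩

/-- At level `0` the only admissible configuration over the datum `V` is `V` itself. [folklore] -/
theorem eq_of_admissible_zero {N : ℕ} {ε : ℝ} {V U : Site 4 → Fin 4 → (Matrix n n ℂ)ˣ} (hU : U ∈ admissible (sfClass 4 2 N ε) 2 0 V) : U = V := hU.2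

set_option maxHeartbeats 800000 in
/-- **(8)∀ FOR SU(2), `d = 4`, `L = 2`: EVERY MINIMISER IS INTERIOR WITH RELATIVE RADIUS `ε∕4`** (statement and argument in the file header). [folklore] -/
theorem all_minimisers_small_SU2 [Nonempty n] (hn : Fintype.card n = 2) :
    ∃ ε₀ : ℝ, 0 < ε₀ ∧ ∀ ε : ℝ, 0 < ε → ε ≤ ε₀ → ∀ (N : ℕ) [NeZero N], 1 ≤ N →
      ∃ δV : ℝ, 0 < δV ∧
        ∀ V ∈ {V : Site 4 → Fin 4 → (Matrix n n ℂ)ˣ | IsUnitaryCfg V ∧ IsPeriodicCfg V (N : ℤ) ∧ SmallField V δV},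
        ∀ (k : ℕ) (U : Site 4 → Fin 4 → (Matrix n n ℂ)ˣ), IsMinimiser 4 (sfClass 4 2 N ε) 2 N k V U →
          SmallField U ((ε / 4) / (((2 : ℕ) : ℝ) ^ k) ^ 2) := by
  obtain ⟨ε₁, hε₁, H⟩ := hint_SU2_small_data (n := n) hn
  obtain ⟨ε₂, hε₂, CS, hCS, νc, hνc, κc, hκc, hdec⟩ := decomp_of_nl0_pair (n := n)
  -- the k-free line of gen 104 with the Poincaré constant `8·CPLine + 1`
  obtain ⟨CP, hCP⟩ : ∃ CP : ℝ, CP = 8 * CPLine 4 2 2 (1 / 10 ^ 17) (1 / 10 ^ 53) + 1 := ⟨_, rfl⟩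
  have hCP1 : 1 ≤ CP := by rw [hCP]; have := CPLine_nonneg_d4_L2; linarith
  have hCP0 : 0 ≤ CP := by linarith
  obtain ⟨Q, hQ⟩ : ∃ Q : ℝ, Q = 2 * (1 + CP) := ⟨_, rfl⟩
  have hQ4 : 4 ≤ Q := by rw [hQ]; linarith
  obtain ⟨cL, hcL⟩ : ∃ cL : ℝ, cL = 2 * κc + νc ^ 2 + 2304 * (CS ^ 2 * Real.exp (2 * CS)) + 112 * (1 + 7 * CS ^ 2) + 1 := ⟨_, rfl⟩
  have hcL0 : 0 < cL := by rw [hcL]; positivity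
  have hQ0 : 0 < Q := by linarith
  obtain ⟨ε₃, hε₃⟩ : ∃ ε₃ : ℝ, ε₃ = (1 / 2) / Q / 4 / cL := ⟨_, rfl⟩
  have hε₃0 : 0 < ε₃ := by rw [hε₃]; positivity
  have hcard : (0 : ℝ) < 1000000000000000000000 * (Fintype.card n : ℝ) := by rw [hn]; norm_num
  refine ⟨min ε₁ (min ε₂ (min (1 / 10 ^ 53) (min (1 / (1000000000000000000000 * (Fintype.card n : ℝ))) (min ε₃ 1)))),
    lt_min hε₁ (lt_min hε₂ (lt_min (by norm_num) (lt_min (by positivity) (lt_min hε₃0 one_pos)))), ?_⟩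
  intro ε hε hεle N _ hN
  have hεε₁ : ε ≤ ε₁ := hεle.trans (min_le_left _ _)
  have hεε₂ : ε ≤ ε₂ := hεle.trans ((min_le_right _ _).trans (min_le_left _ _))
  have hε53 : ε ≤ 1 / 10 ^ 53 := hεle.trans ((min_le_right _ _).trans ((min_le_right _ _).trans (min_le_left _ _)))
  have hεθ : ε ≤ 1 / (1000000000000000000000 * (Fintype.card n : ℝ)) :=
    hεle.trans ((min_le_right _ _).trans ((min_le_right _ _).trans ((min_le_right _ _).trans (min_le_left _ _))))
  have hεε₃ : ε ≤ ε₃ := hεle.trans ((min_le_right _ _).trans ((min_le_right _ _).trans ((min_le_right _ _).trans ((min_le_right _ _).trans (min_le_left _ _)))))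
  have hε1 : ε ≤ 1 := hεle.trans ((min_le_right _ _).trans ((min_le_right _ _).trans ((min_le_right _ _).trans ((min_le_right _ _).trans (min_le_right _ _)))))
  have hε11' : ε / 4 ≤ 1 / 10 ^ 11 := by linarith
  have hε4 : 0 < ε / 4 := by positivity
  have hθline : 1000000000000000000000 * (Fintype.card n : ℝ) * ε ≤ 1 := by
    rw [le_div_iff₀ hcard] at hεθ; linarith
  have hsmall : cL * ε ≤ (1 / 2) / Q / 4 := by
    have h1 : cL * ε ≤ cL * ε₃ := mul_le_mul_of_nonneg_left hεε₃ hcL0.le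
    have h2 : cL * ε₃ = (1 / 2) / Q / 4 := by rw [hε₃]; field_simp
    linarith only [h1, h2]
  have hline := line_of_small hQ4 hCS hε hε1 (by rw [← hcL]; exact hsmall)
  -- the (8)∃ minimisers of the SMALLER class `sfClass 4 2 N (ε/4)`
  obtain ⟨δV', hδV', hint'⟩ := H (ε / 4) hε4 (by linarith) N hN
  refine ⟨min δV' (ε / 4), lt_min hδV' hε4, ?_⟩
  intro V hV k U hU
  obtain ⟨hVu, hVP, hVδ⟩ := hV
  cases k with
  | zero =>
      -- level 0: `U = V`
      have hUV : U = V := eq_of_admissible_zero hU.mem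
      rw [hUV]
      have e : (ε / 4) / (((2 : ℕ) : ℝ) ^ 0) ^ 2 = ε / 4 := by norm_num
      rw [e]
      exact MinimalActionRate.SmallField.mono hVδ (min_le_right _ _)
  | succ j =>
      have hV' : V ∈ {V : Site 4 → Fin 4 → (Matrix n n ℂ)ˣ | IsUnitaryCfg V ∧ IsPeriodicCfg V (N : ℤ) ∧ SmallField V δV'} :=
        ⟨hVu, hVP, MinimalActionRate.SmallField.mono hVδ (min_le_left _ _)⟩
      obtain ⟨Us, hUs, a, ha0, haε, hUsa⟩ := hint' V hV' (j + 1)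
      -- `U♯` is admissible in the `ε`-class, interior in its own class, tangent-critical
      have hmem : Us ∈ admissible (sfClass 4 2 N ε) 2 (j + 1) V := admissible_mono_radius (by linarith) hUs.mem
      have hls4 := levelSmall_all_d4_L2 hε4.le hε11' j
      have hcrit := tanCritical_of_isMinimiser (le_refl 1 |>.trans one_le_two) hN hUs ha0 haε hUsa hls4
      have hUsr : SmallField Us ((ε / 4) / (((2 : ℕ) : ℝ) ^ (j + 1)) ^ 2) := MinimalActionRate.SmallField.mono hUsa haε.le
      have hM1 : (1 : ℝ) ≤ ((2 : ℕ) : ℝ) ^ (j + 1) := one_le_pow₀ (by norm_num)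
      -- ALL-SMALL on the SU(2) class over `𝒯_E`, the per-pair REP with the gauge identity from the pair decomposition
      refine allSmall_SU2_of_tanCritical_repE_gauge hn hN hε hε53 hmem hcrit ?_ hUsr U hU.mem (hU.le Us hmem)
      intro U' hU'
      obtain ⟨u, X, XT, XN, α, ν, κ, hu, -, hXs, hXP, hα, hXα, hgauge, hXdec, hXT, -, hXN, hν, hNw, hN1, hαM, hνle, hκle⟩ :=
        hdec N ε hε hεε₂ hθline V j Us hmem U' hU'
      refine ⟨u, X, XT, XN, α, ν, κ, hu, hXs, hXP, hα, hXα, hgauge, hXdec, hXT, hXN, hν, hNw, hN1, ?_⟩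
      -- the per-level strict line from the k-free one
      have hck := kfree_coercivity (ε := ε) hCP0 hM1 hν hνle hα hαM
      rw [hQ] at hline
      rw [hn]
      have h2κ : 2 * κ ≤ 2 * (κc * ε) := by linarith
      push_cast at hck hline ⊢
      rw [hCP] at hck hline
      linarith
  
end

end Summit.QuantumFields.BalabanUV.T4Continuum.NE7AllMinimisersSmallSU2
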